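import Summits.AtomisticToContinuum.HydrodynamicLimit.Theses.InformationPercolationEngine
import Literature.MathematicalPhysics.KineticTheory.VelocityBlindPlacement
import Literature.Probability.Process.StableLikeJumpChainEntropy

/-!
# Gibbs floor and Cesàro bookkeeping for the local-equilibrium stub of the chain-rule line

Helper for the crux `InformationPercolationEngine.PercolationClosesChaos` (stmt-AtomisticToContinuum-15178), line
`equilibrium-forecast-chain-rule` (skeleton `Cruxes/PercolationClosesChaos/Lines/equilibrium_forecast_chain_rule.lean`),
stub S5 `stub_cesaroLocalEquilibrium` (`PredictableProjection → MesoConditionalEquidistribution → LocalCountUI →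
NoMesoscopicOscillation → CoarseLocalMaxwellianity`). The stub itself is NOT landed here (wave-1 audit: its second
antecedent is mis-conditioned for the intended sequential chain rule); this file lands the two antecedent-free pieces of
its intended proof, sorry-free:

1. **The floor of the telescoping sum.** S5 telescopes `H_k = (cℓ)³ Σ_q min (relEntAt (kΔ) q, R)` and needs `H_k ≥ 0`,
   i.e. `relEnt ϑ w P ≥ 0` for the smoothed relative entropy of the skeleton's §3,
   `relEnt ϑ w P = ∫ f̂ log (f̂ / M_{1, u, θ + ϑ²})` with `f̂ = kde ϑ w P` the Gaussian kernel density estimate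
   `|P|⁻¹ Σ_{i ∈ P} M_{1, v_i, ϑ²}` of the population's velocities and `u, θ` its own mean velocity and temperature.
   `integral_kde_mul_log_div_nonneg` proves this for EVERY `ϑ, P` and every reference Maxwellian of positive
   temperature, written out over the importable vocabulary (`localMaxwellian`, `V3`) so that the skeleton's
   `0 ≤ relEnt ϑ w P` is the special case `relEnt_nonneg_unfolded` by `unfold relEnt kde temp meanVel`: for
   `P ≠ ∅, ϑ ≠ 0` both densities have unit mass (`integral_localMaxwellian_one`) and the pointwise Gibbs bound
   `f log (f / g) ≥ f − g` (tree `Literature.Probability.Process.sub_le_mul_log_div`) integrates to `≥ 0` when the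
   integrand is integrable, while a non-integrable integrand has Bochner integral `0`; for `P = ∅` or `ϑ = 0` the estimate vanishes identically
   (`(0 : ℝ)⁻¹ = 0`, `(2π·0)^{-3/2} = 0`) and the integral is `0`. No integrability hypothesis survives.
2. **The Cesàro bookkeeping.** `cesaro_drift_le`: if the weighted realised drifts `a_i` of finitely many unit-steps have
   a telescoping floor `−R₀ ≤ Σ w a_i`, differ from the forecast drifts `f_i` by at most the projection remainder `ρ`
   in sum, and each forecast drift is `≤ s + R·irr_i − κ·bad_i` (slack, irregular mass, H-theorem gain on the bad =
   regular non-Maxwellian mass), then `Σ w bad_i ≤ (R₀ + ρ + s·w·#units + R Σ w irr_i) / κ` — the inequality behind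
   "unit-fraction(regular ∧ non-Maxwellian) `≤ (R/K_N + s + R δ' + o(1)) / κ`" of the S5 docstring.

## References
* T. M. Cover, J. A. Thomas, *Elements of Information Theory*, 2nd ed. (2006), Thm. 8.6.1 (Gibbs' inequality for
  densities, via `log x ≤ x − 1`).
-/

noncomputable section

open MeasureTheory
open Literature.Analysis.FluidPDE Literature.MathematicalPhysics.KineticTheory
open Literature.MathematicalPhysics.KineticTheory.VelocityBlindPlacement

namespace Summit.AtomisticToContinuum.HydrodynamicLimit.Theorems.EquilibriumForecastLine

/-! ## §1 Gibbs' inequality in Lean's junk-tolerant form -/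

/-- **Gibbs' inequality, junk-tolerant.** For integrable `f ≥ 0` and `g > 0` with `∫ g ≤ ∫ f`,
`0 ≤ ∫ f log (f / g)` — whether or not the integrand is integrable (if it is not, the Bochner integral is `0`).
[folklore] -/
theorem integral_mul_log_div_nonneg {α : Type*} [MeasurableSpace α] {μ : Measure α} {f g : α → ℝ}
    (hf : Integrable f μ) (hg : Integrable g μ) (hf0 : ∀ x, 0 ≤ f x) (hg0 : ∀ x, 0 < g x)
    (hfg : ∫ x, g x ∂μ ≤ ∫ x, f x ∂μ) :
    0 ≤ ∫ x, f x * Real.log (f x / g x) ∂μ := by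
  by_cases hint : Integrable (fun x => f x * Real.log (f x / g x)) μ
  · have h1 : ∫ x, (f x - g x) ∂μ ≤ ∫ x, f x * Real.log (f x / g x) ∂μ :=
      integral_mono (hf.sub hg) hint fun x => Literature.Probability.Process.sub_le_mul_log_div (hf0 x) (hg0 x)
    rw [integral_sub hf hg] at h1
    linarith
  · rw [integral_undef hint]

/-! ## §2 The Gaussian kernel density estimate of a finite velocity family -/

variable {ι : Type*}

/-- The kernel density estimate `|P|⁻¹ Σ_{i ∈ P} M_{1, u_i, ϑ²}` is nonnegative. [folklore] -/
theorem kde_nonneg (P : Finset ι) (u : ι → V3) (ϑ : ℝ) (v : V3) :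
    0 ≤ ((P.card : ℝ))⁻¹ * ∑ i ∈ P, localMaxwellian 1 (ϑ ^ 2) (u i) v :=
  mul_nonneg (inv_nonneg.2 (Nat.cast_nonneg _))
    (Finset.sum_nonneg fun i _ => localMaxwellian_nonneg zero_le_one (sq_nonneg ϑ) (u i) v)

/-- The kernel density estimate is integrable (`ϑ ≠ 0`). [folklore] -/
theorem integrable_kde (P : Finset ι) (u : ι → V3) {ϑ : ℝ} (hϑ : ϑ ≠ 0) :
    Integrable (fun v : V3 => ((P.card : ℝ))⁻¹ * ∑ i ∈ P, localMaxwellian 1 (ϑ ^ 2) (u i) v) := by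
  have hθ : 0 < ϑ ^ 2 := by positivity
  exact (integrable_finsetSum P fun i _ => integrable_localMaxwellian hθ (u i)).const_mul _

/-- The kernel density estimate of a nonempty family has unit mass (`ϑ ≠ 0`). [folklore] -/
theorem integral_kde_eq_one {P : Finset ι} (hP : P.Nonempty) (u : ι → V3) {ϑ : ℝ} (hϑ : ϑ ≠ 0) :
    ∫ v : V3, ((P.card : ℝ))⁻¹ * ∑ i ∈ P, localMaxwellian 1 (ϑ ^ 2) (u i) v = 1 := by
  have hθ : 0 < ϑ ^ 2 := by positivity
  have hcard : (P.card : ℝ) ≠ 0 := Nat.cast_ne_zero.2 hP.card_pos.ne'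
  rw [integral_const_mul, integral_finsetSum P fun i _ => integrable_localMaxwellian hθ (u i)]
  simp only [integral_localMaxwellian_one hθ, Finset.sum_const, nsmul_eq_mul, mul_one]
  exact inv_mul_cancel₀ hcard

/-- The kernel density estimate of the empty family vanishes identically (`(0 : ℝ)⁻¹ = 0`). [folklore] -/
theorem kde_empty (u : ι → V3) (ϑ : ℝ) (v : V3) :
    (((∅ : Finset ι).card : ℝ))⁻¹ * ∑ i ∈ (∅ : Finset ι), localMaxwellian 1 (ϑ ^ 2) (u i) v = 0 := by
  simp

/-- At zero smoothing the kernel density estimate vanishes identically (`(2π · 0) ^ (−3/2) = 0` in `ℝ`). [folklore] -/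
theorem kde_zero_smoothing (P : Finset ι) (u : ι → V3) (v : V3) :
    ((P.card : ℝ))⁻¹ * ∑ i ∈ P, localMaxwellian 1 ((0 : ℝ) ^ 2) (u i) v = 0 := by
  have h : ∀ i ∈ P, localMaxwellian 1 ((0 : ℝ) ^ 2) (u i) v = 0 := fun i _ => by
    simp [localMaxwellian, Real.zero_rpow]
  rw [Finset.sum_congr rfl h, Finset.sum_const_zero, mul_zero]

/-- **Gibbs floor for the smoothed relative entropy.** For every finite velocity family, every smoothing `ϑ` and every
reference Maxwellian of positive temperature `θ` and arbitrary centre `m`,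
`0 ≤ ∫ f̂ log (f̂ / M_{1, m, θ})` with `f̂ = |P|⁻¹ Σ_{i ∈ P} M_{1, u_i, ϑ²}` — no side condition (empty family or
`ϑ = 0`: `f̂ ≡ 0` and the integral is `0`; otherwise Gibbs with unit masses, junk-tolerant). [folklore] -/
theorem integral_kde_mul_log_div_nonneg (P : Finset ι) (u : ι → V3) (ϑ : ℝ) {θ : ℝ} (hθ : 0 < θ) (m : V3) :
    0 ≤ ∫ v : V3, (((P.card : ℝ))⁻¹ * ∑ i ∈ P, localMaxwellian 1 (ϑ ^ 2) (u i) v) *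
      Real.log ((((P.card : ℝ))⁻¹ * ∑ i ∈ P, localMaxwellian 1 (ϑ ^ 2) (u i) v) /
        localMaxwellian 1 θ m v) := by
  rcases P.eq_empty_or_nonempty with rfl | hP
  · simp
  by_cases hϑ : ϑ = 0
  · subst hϑ
    simp only [kde_zero_smoothing, zero_mul, integral_zero, le_refl]
  refine integral_mul_log_div_nonneg (integrable_kde P u hϑ) (integrable_localMaxwellian hθ m)
    (kde_nonneg P u ϑ) (fun v => localMaxwellian_pos one_pos hθ m v) ?_
  rw [integral_kde_eq_one hP u hϑ, integral_localMaxwellian_one hθ m]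

/-- The empirical temperature `|P|⁻¹ Σ_{i ∈ P} ‖u_i − ū‖² / 3` is nonnegative. [folklore] -/
theorem temp_nonneg_unfolded (P : Finset ι) (u : ι → V3) (m : V3) :
    0 ≤ ((P.card : ℝ))⁻¹ * ∑ i ∈ P, ‖u i - m‖ ^ 2 / 3 :=
  mul_nonneg (inv_nonneg.2 (Nat.cast_nonneg _)) (Finset.sum_nonneg fun i _ => by positivity)

/-- **`relEnt ≥ 0` for the skeleton, unfolded.** With `kde ϑ w P v = |P|⁻¹ Σ_{i ∈ P} M_{1, v_i, ϑ²}(v)`,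
`meanVel w P = |P|⁻¹ Σ v_i`, `temp w P = |P|⁻¹ Σ ‖v_i − meanVel‖² / 3` and
`relEnt ϑ w P = ∫ kde · log (kde / M_{1, meanVel, temp + ϑ²})` (§3 of the line skeleton, bodies written out verbatim over
`Phase N`), `0 ≤ relEnt ϑ w P` for ALL `ϑ, w, P`: the floor `H_k ≥ 0` of S5's telescoping sum. [folklore] -/
theorem relEnt_nonneg_unfolded {N : ℕ} (ϑ : ℝ) (w : Phase N) (P : Finset (Fin (N + 1))) :
    0 ≤ ∫ v : V3, (((P.card : ℝ))⁻¹ * ∑ i ∈ P, localMaxwellian 1 (ϑ ^ 2) (w i).2 v) *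
      Real.log ((((P.card : ℝ))⁻¹ * ∑ i ∈ P, localMaxwellian 1 (ϑ ^ 2) (w i).2 v) /
        localMaxwellian 1
          (((P.card : ℝ))⁻¹ * ∑ i ∈ P, ‖(w i).2 - ((P.card : ℝ))⁻¹ • ∑ i ∈ P, (w i).2‖ ^ 2 / 3 + ϑ ^ 2)
          (((P.card : ℝ))⁻¹ • ∑ i ∈ P, (w i).2) v) := by
  by_cases hϑ : ϑ = 0
  · subst hϑ
    simp only [kde_zero_smoothing, zero_mul, integral_zero, le_refl]
  have hθ : 0 < ((P.card : ℝ))⁻¹ * ∑ i ∈ P, ‖(w i).2 - ((P.card : ℝ))⁻¹ • ∑ i ∈ P, (w i).2‖ ^ 2 / 3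
      + ϑ ^ 2 :=
    add_pos_of_nonneg_of_pos (temp_nonneg_unfolded P (fun i => (w i).2) _) (by positivity)
  exact integral_kde_mul_log_div_nonneg P (fun i => (w i).2) ϑ hθ _

/-- **Registered sub-goal of S5: the Gibbs floor** — `0 ≤ relEnt ϑ w P` for all `ϑ, w, P`, as a closed statement over
the importable vocabulary (the skeleton's §3 bodies written out; closes `0 ≤ relEnt ϑ w P` there by `exact`). [folklore] -/
theorem stub_cesaroLocalEquilibrium_relEntFloor :
    ∀ {N : ℕ} (ϑ : ℝ) (w : Phase N) (P : Finset (Fin (N + 1))),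
      0 ≤ ∫ v : V3, (((P.card : ℝ))⁻¹ * ∑ i ∈ P, localMaxwellian 1 (ϑ ^ 2) (w i).2 v) *
        Real.log ((((P.card : ℝ))⁻¹ * ∑ i ∈ P, localMaxwellian 1 (ϑ ^ 2) (w i).2 v) /
          localMaxwellian 1
            (((P.card : ℝ))⁻¹ * ∑ i ∈ P, ‖(w i).2 - ((P.card : ℝ))⁻¹ • ∑ i ∈ P, (w i).2‖ ^ 2 / 3 + ϑ ^ 2)
            (((P.card : ℝ))⁻¹ • ∑ i ∈ P, (w i).2) v) :=
  fun ϑ w P => relEnt_nonneg_unfolded ϑ w P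

/-! ## §3 The Cesàro bookkeeping of S5 -/

/-- **Cesàro drift bookkeeping.** Finitely many unit-steps `i ∈ U` with common weight `w ≥ 0` (the cell volume `(cℓ)³`),
realised drifts `a_i`, forecast drifts `f_i`, irregular masses `irr_i` and bad (regular ∧ non-Maxwellian) masses `bad_i`:
a telescoping floor `−R₀ ≤ Σ w a_i`, a projection remainder `Σ w a_i ≤ Σ w f_i + ρ` and the forecast bound
`f_i ≤ s + R irr_i − κ bad_i` (`κ > 0`) give `Σ w bad_i ≤ (R₀ + ρ + s · (w · #U) + R Σ w irr_i) / κ`. [folklore] -/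
theorem cesaro_drift_le (U : Finset ι) {w κ : ℝ} (R₀ ρ s R : ℝ) (a f bad irr : ι → ℝ)
    (hw : 0 ≤ w) (hκ : 0 < κ)
    (htel : -R₀ ≤ ∑ i ∈ U, w * a i)
    (hpp : ∑ i ∈ U, w * a i ≤ ∑ i ∈ U, w * f i + ρ)
    (hfore : ∀ i ∈ U, f i ≤ s + R * irr i - κ * bad i) :
    ∑ i ∈ U, w * bad i ≤ (R₀ + ρ + s * (w * U.card) + R * ∑ i ∈ U, w * irr i) / κ := by
  rw [le_div_iff₀ hκ]
  have h1 : ∑ i ∈ U, w * f i ≤ ∑ i ∈ U, (s * w + R * (w * irr i) - κ * (w * bad i)) :=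
    Finset.sum_le_sum fun i hi => by nlinarith [mul_le_mul_of_nonneg_left (hfore i hi) hw]
  rw [Finset.sum_sub_distrib, Finset.sum_add_distrib] at h1
  have hbad : κ * ∑ i ∈ U, w * bad i = ∑ i ∈ U, κ * (w * bad i) := Finset.mul_sum _ _ _
  have hirr : R * ∑ i ∈ U, w * irr i = ∑ i ∈ U, R * (w * irr i) := Finset.mul_sum _ _ _
  have hs : ∑ _i ∈ U, s * w = s * (w * U.card) := by
    rw [Finset.sum_const, nsmul_eq_mul]; ring
  linarith [htel, hpp, h1, hbad, hirr, hs]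

end Summit.AtomisticToContinuum.HydrodynamicLimit.Theorems.EquilibriumForecastLine

end
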